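import Summits.ResolutionOfSingularities.ResolutionOfSingularities.Theorems.AQSHeightTwoPlusStalkAffine
import Literature.AlgebraicGeometry.Resolution.RegularLocalOrderValuation
import HarnessLib

/-!
# (o25) «F-AQS-T in the kernel», piece (γ2) — BRICK A′: the ORDER read-off through a model of the stalk

Route `ResolutionOfSingularities/WeightedInvariant`, crux `Theses.WeightedInvariant.HypersurfaceCentreConstruction`
(stmt-ResolutionOfSingularities-19897), ORDER (o25) of res-L1-w43-plan-1, design res-type-092 `O25-DESIGN.md` §2, piece (γ2) PLUS-STALK
(holder res-type-089, second hand res-type-057).  The last step of (γ2) reads `idealOrder (R.cobordantStrictTransform U X) b` through the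
stalk model `Ψ : 𝒪_{B₊(U), b} ≃+* O'` of BRICK A (`AQSHeightTwoPlusStalkAffine`) composed with the game-ring transfer: this file records the
generic read-off
* `idealOrder_eq_adicOrder_of_stalkIdeal_eq_span` — `ord_b(K) = ord_𝔪(g)` for a principal stalk `K_b = (g)`;
* `idealOrder_eq_adicOrder_of_map_ringEquiv` — if `Ψ : 𝒪_{Y,b} ≃+* O'` carries `K_b` onto `(γ)` then `ord_b(K) = ord_{𝔪_{O'}}(γ)`
(the ORDER twin of stub-9's `iotaAt_eq_of_map_ringEquiv`, `…CentreAssemblyPullback`).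

Def-free helper (`--supports stmt-ResolutionOfSingularities-19897`); OURS bookkeeping, no claim about resolution in positive characteristic.
AI-written; weaker than expert review.  [cite: BierstoneGrigorievMilmanWlodarczyk2011, §3.1 p. 6]
-/

noncomputable section

set_option linter.dupNamespace false -- mandated namespace of this single-conjunct summit

open CategoryTheory AlgebraicGeometry TopologicalSpace IsLocalRing
open Literature.AlgebraicGeometry.Resolution
open Summit.ResolutionOfSingularities.ResolutionOfSingularities.Cruxes.HypersurfaceCentreConstruction.LocalEngine

namespace Summit.ResolutionOfSingularities.ResolutionOfSingularities.Theorems.AQSHeightTwo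

/-- `ord_b(K)` of a principal stalk `K_b = (g)` is the `𝔪`-adic order of the generator `g`. [folklore] -/
theorem idealOrder_eq_adicOrder_of_stalkIdeal_eq_span {Y : Scheme.{0}} (K : Y.IdealSheafData) (b : Y)
    {g : Y.presheaf.stalk b} (hg : stalkIdeal K b = Ideal.span {g}) : idealOrder K b = adicOrder g := by
  refine ENat.eq_of_forall_natCast_le_iff fun n => ?_
  rw [le_idealOrder_iff, le_adicOrder_iff, hg, Ideal.span_singleton_le_iff_mem]

/-- **ORDER READ-OFF through a model of the stalk**: if `Ψ : 𝒪_{Y,b} ≃+* O'` carries the stalk `K_b` onto the principal ideal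
`(γ)`, then `ord_b(K) = ord_{𝔪_{O'}}(γ)`. [folklore] -/
theorem idealOrder_eq_adicOrder_of_map_ringEquiv {Y : Scheme.{0}} (K : Y.IdealSheafData) (b : Y)
    {O' : Type} [CommRing O'] [IsLocalRing O'] (Ψ : Y.presheaf.stalk b ≃+* O') {γ : O'}
    (hγ : (stalkIdeal K b).map (Ψ : Y.presheaf.stalk b →+* O') = Ideal.span {γ}) :
    idealOrder K b = adicOrder γ := by
  have hg : stalkIdeal K b = Ideal.span {Ψ.symm γ} := by
    have h := congrArg (Ideal.map (Ψ.symm : O' →+* Y.presheaf.stalk b)) hγ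
    rw [Ideal.map_of_equiv, Ideal.map_span, Set.image_singleton] at h
    exact h
  -- `ord_𝔪` is invariant under the isomorphism `Ψ` of local rings (cf. `S10LLChainMod.adicOrder_ringEquiv` in the
  -- Hironaka2017 library; re-derived inline from `map_mem_pow_maximalIdeal_of_ringEquiv` to keep the import light)
  refine (idealOrder_eq_adicOrder_of_stalkIdeal_eq_span K b hg).trans (ENat.eq_of_forall_natCast_le_iff fun n => ?_)
  rw [le_adicOrder_iff, le_adicOrder_iff]
  refine ⟨fun h => ?_, fun h => ?_⟩
  · have h' := map_mem_pow_maximalIdeal_of_ringEquiv Ψ h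
    rwa [RingEquiv.apply_symm_apply] at h'
  · exact map_mem_pow_maximalIdeal_of_ringEquiv Ψ.symm h

end Summit.ResolutionOfSingularities.ResolutionOfSingularities.Theorems.AQSHeightTwo

end
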